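import Summits.NavierStokesRegularity.NavierStokesRegularity.Theorems.AdaptedFrequencyTangentFlowTransferFrequencyTools
import HarnessLib

/-!
# Transfer of the adapted frequency to the limit of the blow-up sequence
# (route `AdaptedFrequency`, item `TangentFlowTransfer`, stmt-NavierStokesRegularity-10494)

Helper file (all results proved). Step (S8b) of the transfer: along the zoomed blow-up sequence
`(w_k, g_k)` (classical, Type I with a common constant, Oseen-mild on windows `[A_k, 0)` with
`A_k → −∞`; `g_k` adapted kernels with a common Gaussian upper bound) converging pointwise with two
spatial derivatives to a classical `(W, K)` (`K` an adapted kernel of `W` on `(−∞, 0)`), the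
adapted frequencies `Λ_k(τ) → Λ₀` force `Λ_{W,K}(τ) = Λ₀` at every `τ < 0` where the limit
adapted enstrophy is positive (`adaptedFrequency_limit_eq`).

Mechanism (`limit_frequency_eq_forall`): on `U = (2τ, τ/2)` the Type-I window regularity gives
`C³` bounds on `w_k` uniform in `k ≥ k₀` (`exists_slab_bounds_of_typeI_windows`), hence uniform
bounds on the enstrophy density `q_k = ‖curl w_k‖²` and on `L q_k`
(`exists_enstrophyDensity_bounds`); the kernels are dominated on `U` by one Gaussian; so
`H_k′ = ∫ (L q_k) g_k` (`hasDerivAt_adaptedEnstrophy_window`) is bounded uniformly,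
`H_k → H̄` and `H_k′ → ∫ (L q_W) K` by dominated convergence (`L q = 2⟪ω, Du ω⟫ − 2|Dω|²` involves
two derivatives only), the latter is continuous in `τ`, and the frequency identity passes to the
limit.
-/

noncomputable section

open MeasureTheory Set Function Filter TopologicalSpace Metric
open scoped Topology InnerProductSpace RealInnerProductSpace Laplacian

namespace Summit.NavierStokesRegularity.NavierStokesRegularity.Theorems

open Literature.Analysis Literature.Analysis.FluidPDE

local notation "ℝ³" => EuclideanSpace ℝ (Fin 3)


/-! ### Uniform `C³` bounds on `U = (2τ, τ/2)` along Type-I windows -/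

/-- **Uniform `C³` slab bounds.** For `C₀ ≥ 0` and `τ < 0` there is `M ≥ 0` such that every
classical, Oseen-mild, Type-I (constant `C₀`) field on a window `[A, 0)` with `A < 3τ` obeys
`‖u‖, ‖Du‖, ‖D²u‖, ‖D³u‖ ≤ M` on `(2τ, τ/2) × ℝ³` (`exists_norm_iteratedFDeriv_le_of_typeI_window`,
levels `0 … 3`). [folklore] -/
theorem exists_slab_bounds_of_typeI_windows {C₀ : ℝ} (hC₀ : 0 ≤ C₀) {τ : ℝ} (hτ : τ < 0) :
    ∃ M : ℝ, 0 ≤ M ∧ ∀ ⦃A : ℝ⦄ ⦃u : ℝ → ℝ³ → ℝ³⦄ ⦃p : ℝ → ℝ³ → ℝ⦄, A < 3 * τ →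
      IsClassicalNSSolutionOn (Ico A 0) 1 0 u p →
      (∀ s t : ℝ, A < s → s < t → t < 0 → ∀ x,
        u t x = UnboundedOperators.heatExtension (u s) (t - s) x - oseenDuhamel 1 s u u t x) →
      (∀ t ∈ Ioo A 0, ∀ x, ‖u t x‖ ≤ C₀ / Real.sqrt (-t)) →
      ∀ t ∈ Ioo (2 * τ) (τ / 2), ∀ x, ‖u t x‖ ≤ M ∧ ‖fderiv ℝ (u t) x‖ ≤ M ∧
        ‖iteratedFDeriv ℝ 2 (u t) x‖ ≤ M ∧ ‖iteratedFDeriv ℝ 3 (u t) x‖ ≤ M := by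
  have hab : 3 * τ < τ / 4 := by linarith
  have hb : τ / 4 < 0 := by linarith
  have hδ : 0 < -τ := by linarith
  obtain ⟨K₀, hK₀⟩ := exists_norm_iteratedFDeriv_le_of_typeI_window hC₀ 0 hab hb hδ
  obtain ⟨K₁, hK₁⟩ := exists_norm_iteratedFDeriv_le_of_typeI_window hC₀ 1 hab hb hδ
  obtain ⟨K₂, hK₂⟩ := exists_norm_iteratedFDeriv_le_of_typeI_window hC₀ 2 hab hb hδ
  obtain ⟨K₃, hK₃⟩ := exists_norm_iteratedFDeriv_le_of_typeI_window hC₀ 3 hab hb hδ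
  refine ⟨max (max (max K₀ K₁) (max K₂ K₃)) 0, le_max_right _ _, ?_⟩
  intro A u p hA hcl hmild hI t ht x
  have hcont : ContinuousOn (uncurry u) (Ioo A 0 ×ˢ univ) :=
    hcl.smooth_velocity.continuousOn.mono (prod_mono Ioo_subset_Ico_self Subset.rfl)
  have hwdf : ∀ s ∈ Ioo A 0, IsWeaklyDivFree (u s) := fun s hs =>
    VectorCalculus.IsDivFree.isWeaklyDivFree_holds (hcl.divFree s (Ioo_subset_Ico_self hs))
      (contDiff_infty.1 (hcl.contDiff_velocity (Ioo_subset_Ico_self hs)) 1)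
  have ht' : t ∈ Ico (3 * τ + -τ) (τ / 4) := ⟨by linarith [ht.1], by linarith [ht.2]⟩
  have h0 := hK₀ hA hcont hwdf hmild hI t ht' x
  have h1 := hK₁ hA hcont hwdf hmild hI t ht' x
  have h2 := hK₂ hA hcont hwdf hmild hI t ht' x
  have h3 := hK₃ hA hcont hwdf hmild hI t ht' x
  rw [norm_iteratedFDeriv_zero] at h0
  rw [norm_iteratedFDeriv_one] at h1
  refine ⟨h0.trans ?_, h1.trans ?_, h2.trans ?_, h3.trans ?_⟩
  · exact le_trans (le_trans (le_max_left _ _) (le_max_left _ _)) (le_max_left _ _)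
  · exact le_trans (le_trans (le_max_right _ _) (le_max_left _ _)) (le_max_left _ _)
  · exact le_trans (le_trans (le_max_left _ _) (le_max_right _ _)) (le_max_left _ _)
  · exact le_trans (le_trans (le_max_right _ _) (le_max_right _ _)) (le_max_left _ _)

/-! ### The transfer of the adapted frequency to the limit -/

/-- **Transfer of the adapted frequency along the blow-up sequence** (module docstring). Along a
sequence `(w_k, p_k, g_k)` of classical unit-viscosity solutions on windows `[A_k, 0)`,
`A_k → −∞`, Oseen-mild between window times, Type I with one constant, with adapted kernels `g_k`
(pole `(0,0)`) under one Gaussian, converging pointwise with two spatial derivatives (velocities)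
and pointwise (kernels) to a classical `(W, q)` on `(−∞, 0)` with adapted kernel `K`: if
`Λ_k(τ) → Λ₀` for every `τ < 0` and the limit adapted enstrophy is positive, then
`Λ_{W,K} ≡ Λ₀` on `(−∞, 0)`. [folklore] -/
theorem adaptedFrequency_limit_eq {C₀ : ℝ} (hC₀ : 0 ≤ C₀) {A : ℕ → ℝ} (hA : Tendsto A atTop atBot)
    {w : ℕ → ℝ → ℝ³ → ℝ³} {pw : ℕ → ℝ → ℝ³ → ℝ} {g : ℕ → ℝ → ℝ³ → ℝ}
    (hcl : ∀ k, IsClassicalNSSolutionOn (Ico (A k) 0) 1 0 (w k) (pw k))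
    (hmild : ∀ k, ∀ s t : ℝ, A k < s → s < t → t < 0 → ∀ x,
      w k t x = UnboundedOperators.heatExtension (w k s) (t - s) x -
        oseenDuhamel 1 s (w k) (w k) t x)
    (hI : ∀ k, ∀ t ∈ Ioo (A k) 0, ∀ x, ‖w k t x‖ ≤ C₀ / Real.sqrt (-t))
    (hg : ∀ k, IsAdaptedBackwardKernel 1 (w k) (Ico (A k) 0) 0 0 (g k))
    {C₁ C₂ : ℝ} (hC₁ : 0 ≤ C₁) (hC₂ : 0 < C₂)
    (hgb : ∀ k, ∀ t ∈ Ico (A k) 0, ∀ x, g k t x ≤ C₁ * ((0:ℝ) - t) ^ (-(3:ℝ) / 2) *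
      Real.exp (-(‖x - (0 : ℝ³)‖ ^ 2) / (C₂ * ((0:ℝ) - t))))
    {W : ℝ → ℝ³ → ℝ³} {q : ℝ → ℝ³ → ℝ} (hW : IsClassicalNSSolutionOn (Iio 0) 1 0 W q)
    {K : ℝ → ℝ³ → ℝ} (hK : IsAdaptedBackwardKernel 1 W (Iio 0) 0 0 K)
    (hw1 : ∀ t < 0, ∀ x, Tendsto (fun k => fderiv ℝ (w k t) x) atTop (𝓝 (fderiv ℝ (W t) x)))
    (hw2 : ∀ t < 0, ∀ x, Tendsto (fun k => fderiv ℝ (fderiv ℝ (w k t)) x) atTop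
      (𝓝 (fderiv ℝ (fderiv ℝ (W t)) x)))
    (hgK : ∀ t < 0, ∀ x, Tendsto (fun k => g k t x) atTop (𝓝 (K t x)))
    {Λ₀ : ℝ} (hΛ : ∀ τ < 0, Tendsto (fun k => adaptedFrequency (w k) (g k) 0 τ) atTop (𝓝 Λ₀))
    (hpos : ∀ τ < 0, 0 < adaptedEnstrophy W K τ) :
    ∀ τ < 0, adaptedFrequency W K 0 τ = Λ₀ := by
  intro τ hτ
  -- the window `U = (2τ, τ/2)` and the shift `k₀` beyond which `A_k < 3τ`
  set U : Set ℝ := Ioo (2 * τ) (τ / 2) with hUdef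
  have hUo : IsOpen U := isOpen_Ioo
  have hτU : τ ∈ U := ⟨by linarith, by linarith⟩
  have hUneg : ∀ t ∈ U, t < 0 := fun t ht => by linarith [ht.2]
  obtain ⟨k₀, hk₀⟩ : ∃ k₀ : ℕ, ∀ k ≥ k₀, A k < 3 * τ :=
    eventually_atTop.1 (hA.eventually (eventually_lt_atBot (3 * τ)))
  have hUsub : ∀ j, U ⊆ Ico (A (j + k₀)) 0 := fun j t ht =>
    ⟨by linarith [hk₀ (j + k₀) (Nat.le_add_left _ _), ht.1], hUneg t ht⟩
  -- uniform `C³` bounds and enstrophy-density bounds on `U`, for the shifted sequence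
  obtain ⟨M, hM0, hM⟩ := exists_slab_bounds_of_typeI_windows hC₀ hτ
  obtain ⟨B, hB⟩ := exists_enstrophyDensity_bounds (1 : ℝ) M
  have hclU : ∀ j, IsClassicalNSSolutionOn U 1 0 (w (j + k₀)) (pw (j + k₀)) := fun j =>
    (hcl _).mono (hUsub j) (uniqueDiffOn_Ioo _ _)
  have hbdU : ∀ j, ∀ t ∈ U, ∀ x, ‖w (j + k₀) t x‖ ≤ M ∧ ‖fderiv ℝ (w (j + k₀) t) x‖ ≤ M ∧
      ‖iteratedFDeriv ℝ 2 (w (j + k₀) t) x‖ ≤ M ∧ ‖iteratedFDeriv ℝ 3 (w (j + k₀) t) x‖ ≤ M :=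
    fun j => hM (hk₀ _ (Nat.le_add_left _ _)) (hcl _) (hmild _) (hI _)
  have hBU := fun j => hB (hclU j) (uniqueDiffOn_Ioo _ _) (hbdU j)
  have hgU : ∀ j, IsAdaptedBackwardKernel 1 (w (j + k₀)) U 0 0 (g (j + k₀)) := fun j =>
    (hg _).mono (hUsub j) (uniqueDiffOn_Ioo _ _)
  -- one Gaussian dominating all kernels on `U`
  set Φ₀ : ℝ³ → ℝ := fun x => C₁ * ((0:ℝ) - τ / 2) ^ (-(3:ℝ) / 2) *
    Real.exp (-(‖x - (0 : ℝ³)‖ ^ 2) / ((4 * C₂) * ((0:ℝ) - τ / 2))) with hΦ₀def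
  have hΦ₀ : Integrable Φ₀ (volume : Measure ℝ³) := integrable_gaussian_dom hC₂ hτ
  have hdomU : ∀ j, ∀ t ∈ U, ∀ x, g (j + k₀) t x ≤ Φ₀ x := fun j t ht x =>
    (hgb _ t (hUsub j ht) x).trans (gaussian_le_gaussian_of_mem_Ioo hC₁ hC₂ hτ ht x)
  -- eventual facts are facts for the shifted sequence
  have hshift : ∀ {P : ℕ → Prop}, (∀ j, P (j + k₀)) → ∀ᶠ k in atTop, P k := by
    intro P h
    refine eventually_atTop.2 ⟨k₀, fun k hk => ?_⟩
    obtain ⟨j, rfl⟩ : ∃ j, k = j + k₀ := ⟨k - k₀, by omega⟩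
    exact h j
  -- the limit kernel is dominated too, and the limit gradients are bounded by `M`
  have hKdom : ∀ t ∈ U, ∀ x, K t x ≤ Φ₀ x := fun t ht x =>
    le_of_tendsto (hgK t (hUneg t ht) x) (hshift fun j => hdomU j t ht x)
  -- slices
  have hw2U : ∀ j, ∀ t ∈ U, ContDiff ℝ 2 (w (j + k₀) t) := fun j t ht =>
    contDiff_infty.1 ((hclU j).contDiff_velocity ht) 2
  have hW2U : ∀ t ∈ U, ContDiff ℝ 2 (W t) := fun t ht =>
    contDiff_infty.1 (hW.contDiff_velocity (hUneg t ht)) 2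
  have hMW : ∀ t ∈ U, ∀ x, ‖fderiv ℝ (W t) x‖ ≤ max M (‖curlCLM‖ * M) ∧
      ‖fderiv ℝ (curl (W t)) x‖ ≤ max M (‖curlCLM‖ * M) := by
    intro t ht x
    have h1n := ((hw1 t (hUneg t ht) x).comp (tendsto_add_atTop_nat k₀)).norm
    have h2n := (tendsto_fderiv_curl (fun j => hw2U j t ht) (hW2U t ht)
      ((hw2 t (hUneg t ht) x).comp (tendsto_add_atTop_nat k₀))).norm
    refine ⟨(le_of_tendsto h1n (Eventually.of_forall fun j => (hbdU j t ht x).2.1)).trans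
      (le_max_left _ _), (le_of_tendsto h2n (Eventually.of_forall fun j => ?_)).trans
      (le_max_right _ _)⟩
    exact (norm_fderiv_curl_le (hw2U j t ht) x).trans
      (mul_le_mul_of_nonneg_left (hbdU j t ht x).2.2.1 (norm_nonneg curlCLM))
  -- the players of `limit_frequency_eq_forall`
  set H : ℕ → ℝ → ℝ := fun j => adaptedEnstrophy (w (j + k₀)) (g (j + k₀)) with hHdef
  set Hbar : ℝ → ℝ := adaptedEnstrophy W K with hHbar
  set Ld : ℕ → ℝ → ℝ³ → ℝ := fun j t x =>
    2 * ⟪curl (w (j + k₀) t) x, fderiv ℝ (w (j + k₀) t) x (curl (w (j + k₀) t) x)⟫ -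
      2 * (1:ℝ) * frobeniusNormSq (fderiv ℝ (curl (w (j + k₀) t)) x) with hLd
  set LW : ℝ → ℝ³ → ℝ := fun t x =>
    2 * ⟪curl (W t) x, fderiv ℝ (W t) x (curl (W t) x)⟫ -
      2 * (1:ℝ) * frobeniusNormSq (fderiv ℝ (curl (W t)) x) with hLW
  set gbar : ℝ → ℝ := fun t => ∫ x, LW t x * K t x with hgbar
  -- derivative of `H_j` on `U`
  have hderiv : ∀ j, ∀ t ∈ U, HasDerivAt (H j) (∫ x, Ld j t x * g (j + k₀) t x) t :=
    fun j t ht => hasDerivAt_adaptedEnstrophy_window (hclU j) (hgU j) hΦ₀ (hdomU j) (hBU j) ht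
  have hdiff : ∀ j, ∀ t ∈ U, DifferentiableAt ℝ (H j) t := fun j t ht =>
    (hderiv j t ht).differentiableAt
  have hderiv_eq : ∀ j, ∀ t ∈ U, deriv (H j) t = ∫ x, Ld j t x * g (j + k₀) t x :=
    fun j t ht => (hderiv j t ht).deriv
  -- uniform bound on `H_j′`
  have hbound : ∀ j, ∀ t ∈ U, |deriv (H j) t| ≤ B + B * B + |(1:ℝ)| * B := by
    intro j t ht
    rw [hderiv_eq j t ht]
    exact abs_integral_opLDensity_mul_le (hclU j) (uniqueDiffOn_Ioo _ _) (hgU j) (hBU j) ht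
  have hgcU : ∀ j, ∀ t ∈ U, Continuous (g (j + k₀) t) := fun j t ht =>
    ((hgU j).contDiff_slice ht).continuous
  -- `H_j → H̄` on `U`
  have hH : ∀ t ∈ U, Tendsto (fun j => H j t) atTop (𝓝 (Hbar t)) := by
    intro t ht
    refine tendsto_adaptedEnstrophy_of_tendsto (fun j => (hw2U j t ht).of_le (by norm_num))
      (fun j => hgcU j t ht) (B := B) (fun j x => ?_) hΦ₀
      (fun j x => ⟨((hgU j).pos t ht x).le, hdomU j t ht x⟩)
      (fun x => (hw1 t (hUneg t ht) x).comp (tendsto_add_atTop_nat k₀))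
      (fun x => (hgK t (hUneg t ht) x).comp (tendsto_add_atTop_nat k₀))
    exact le_of_abs_le (hBU j t ht x).1
  -- `H_j′ → ḡ` on `U`
  have hg' : ∀ t ∈ U, Tendsto (fun j => deriv (H j) t) atTop (𝓝 (gbar t)) := by
    intro t ht
    have e : (fun j => deriv (H j) t) = fun j => ∫ x, Ld j t x * g (j + k₀) t x :=
      funext fun j => hderiv_eq j t ht
    rw [e]
    refine tendsto_integral_opLDensity_of_tendsto (ν := 1) (fun j => hw2U j t ht) (hW2U t ht)
      (fun j => hgcU j t ht) (B := B + B * B + |(1:ℝ)| * B) (fun j x => ?_) hΦ₀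
      (fun j x => ⟨((hgU j).pos t ht x).le, hdomU j t ht x⟩)
      (fun x => (hw1 t (hUneg t ht) x).comp (tendsto_add_atTop_nat k₀))
      (fun x => (hw2 t (hUneg t ht) x).comp (tendsto_add_atTop_nat k₀))
      (fun x => (hgK t (hUneg t ht) x).comp (tendsto_add_atTop_nat k₀))
    exact abs_opLDensity_le (hclU j) (uniqueDiffOn_Ioo _ _) (hBU j) ht x
  -- `ḡ` is continuous on `U`
  have hgc : ContinuousOn gbar U :=
    continuousOn_integral_opLDensity (ν := 1) hUo (hW.smooth_velocity.mono fun t ht => hUneg t ht)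
      (hK.contDiffOn.mono (prod_mono (fun t ht => hUneg t ht) Subset.rfl))
      (fun t ht x => (hK.pos t (hUneg t ht) x).le) hΦ₀ hKdom hMW
  -- positivity and the frequency limits along the shifted sequence
  have hposU : ∀ t ∈ U, 0 < Hbar t := fun t ht => hpos t (hUneg t ht)
  have hΛU : ∀ t ∈ U, Tendsto (fun j => (0 - t) * deriv (H j) t / H j t) atTop (𝓝 Λ₀) :=
    fun t ht => (hΛ t (hUneg t ht)).comp (tendsto_add_atTop_nat k₀)
  -- conclude
  have h := limit_frequency_eq_forall hUo hdiff hbound hH hg' hgc hposU hΛU τ hτU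
  rw [adaptedFrequency_apply]
  exact h

end Summit.NavierStokesRegularity.NavierStokesRegularity.Theorems

end
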